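import Summits.HodgeConjecture.HodgeConjecture.Theorems.VHCAbelianSchemesRoadEllipticPowerAnchors
import Summits.HodgeConjecture.HodgeConjecture.Theorems.Ring2AbelianAllEllipticTensorWeilCarriersDefs
import Literature.AlgebraicGeometry.Andre1996.CMHodgeClassesWeilTensorPencils
import Literature.AlgebraicGeometry.Motives.AimedSplitProductProofs
import HarnessLib

/-!
# Road b02 (`VHCAbelianSchemesRoad`) × the André column — ELLIPTIC TENSOR ANCHORS SERVED BY E-WEIL CLASSES: `HC_CM` from the door and carriers for
# `E`-WEIL classes of CM-field structures on powers of ONE elliptic curve of our choice (cell-free, residual-free, `HC_CM`-free inputs)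

research route, not a corollary; conditional on HC_CM plus one named minimal statement.

PART AB-d (`VHCAbelianSchemesRoadEllipticPowerAnchors`) derived `HC_CM` from the door and carriers for ALL rational algebraic classes on EVERY
abelian variety isogenous to a power of ANY elliptic curve (refined fact `andre1996_cmHodgeClasses_ellipticPowerPencils`: Lemme 6.3.3 (ii)). The
proof of Lemme 6.3.3 (p. 33) gives more at the special fibre: it is the TENSOR POINT `V := V₀ ⊗ E` over `V₀ = H¹(E₀^p)` with `E₀` PRESCRIBED («par
exemple»; any `V₀` serves by Landherr), and the extended class there lies in the `E`-Weil line `⋀^{2p}_E V` (pointwise fixed by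
`G = Res SU(V, φ)`). The Literature named fact `Andre1996.andre1996_cmHodgeClasses_weilTensorPencils` (statement only, this generation; predicate
`IsWeilTensorAnchoredPencilFor E₀ B' p w f d`) records exactly that, in the tree's Weil vocabulary (`weilClassesOf` / `weilClassesField`, binders
verbatim those of `Andre1992_hodgeClasses_cmAbelianVariety_mem_span_pullback_weilClasses`). This file proves:

* §0 the new fact implies the gen-59 fact (`andre1996_cmHodgeClasses_ellipticPowerPencils_of_weilTensorPencils`; an elliptic curve exists in the
  tree: `HodgeTheory.exists_abelianVariety_dim_one_cupProduct_ne_zero`), hence the road's binder #22;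
* §1 a compact pencil with a Weil-tensor special fibre is SERVED there for the anchor data of the node file
  `Ring2AbelianAllEllipticTensorWeilCarriersDefs` — `ellipticPowerPolarisedAnchorOf E₀ n` («`X ≅` an abelian `n`-fold isogenous to a power of the
  FIXED `E₀`, `θ` a polarisation class») / `weilStructureServedClasses n p` («`(p,p)` classes that are `E`-Weil classes of a CM-field structure on `X`»)
  (`hasServedFibre_compactPencil_of_weilTensorFibre`);
* §2 **`cmHodgeHypothesisAt_of_weilTensorPencils_of_door_of_anchoredCarrierAt`**: the new fact ∧ the door for `𝒪` ∧ ONE elliptic curve `E₀` with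
  «`𝒪`-carriers for rational `E`-WEIL classes of CM-field structures, modulo the `θ`-ray, on polarised abelian `d`-folds isogenous to powers of
  `E₀`, `2 ≤ p ≤ d − 2`» ⟹ `CMHodgeHypothesisAt B` for every `B` — `HC_CM` FROM CARRIERS FOR THE (`[E:ℚ]`-DIMENSIONAL SPACES OF) WEIL CLASSES AT
  TENSOR POINTS OVER ONE ELLIPTIC CURVE; with Lemme 6.3.1 and CM-algebraic carriers, `HC_AV` with `HC_CM` IDLE
  (`forall_hodgeConjectureFor_of_andre1996_of_weilTensorPencils_of_door_of_carriers`); twisted-door forms per `C`;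
* §3 the new carrier statement at `(n, p)` FOLLOWS from PART AB's elliptic-power-algebraic one for every `E₀` (served classes are rational `(p,p)`
  classes on an elliptic power, hence algebraic — Tate–Murasaki, `mem_algebraicClasses_of_ellipticPowerAnchor`): the `B_min` SHRINKS.

HONEST: the new fact is a THEOREM IN PRINT vendored as a `Prop` (hypothesis by name; not formalised); every carrier statement is OPEN and NOT implied
by the Hodge conjecture; the door is the road's binder. No span-closed cut between «Weil» and «algebraic» exists at a tensor point (the span of
classes of abelian subvarieties is the whole Lefschetz space; RING2-MAP AA2.489) — the served set is the Weil space itself. Nothing here says any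
carrier, door, `HC_CM`, `HC_AV` or HC holds. References: [cite: Andre1996Motifs, §6.3 Lemme 6.3.2 (p. 32), Lemme 6.3.3 and proof (p. 33)]
[cite: vanGeemen1994HodgeAV, 4.9, Lemma 3.7 and Thm. 4.3] [cite: MoonenZarhin1998WeilClasses, §1] [cite: Deligne1982HodgeCycles, §4 Thm. 4.8 (b), Remark 4.10]
[cite: Bloch1972Semiregularity, Remark (7.5)] [cite: BuchweitzFlenner2003, §5 Thm. 5.1] [cite: Milne1999, §7 p. 72].
-/

noncomputable section

open CategoryTheory CategoryTheory.Limits AlgebraicGeometry Topology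

namespace Summit.HodgeConjecture.HodgeConjecture.Ring2.SemiregularRepresentatives

-- the cell's namespace repeats the summit name (`Summit.HodgeConjecture.HodgeConjecture…`), as in every `Ring2*` file
set_option linter.dupNamespace false

open Literature.AlgebraicGeometry Literature.AlgebraicGeometry.Motives
open Literature.AlgebraicGeometry.HodgeTheory
open Literature.AlgebraicTopology.SingularHomology
open Literature.Barriers.HodgeConjecture (divisorClassesSpan)
open Literature.AlgebraicGeometry.Andre1996 (andre1996_cmAnchoredPencil andre1996_cmHodgeClasses_algebraicallyAnchoredPencils
  andre1996_cmHodgeClasses_ellipticPowerPencils andre1996_cmHodgeClasses_weilTensorPencils IsWeilTensorAnchoredPencilFor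
  compactPencil_dim_eq_of_iso)
open Literature.AlgebraicGeometry.Milne1999 (IsOfCMType CMHodgeHypothesisAt)
open Summit.HodgeConjecture.HodgeConjecture.Ring2.Binders
open Summit.HodgeConjecture.HodgeConjecture.Ring2.ClassTargets
open Summit.Ventures.HSemireg (ObjClass LocalVariationalHodgeFor)
open Summit.HodgeConjecture.HodgeConjecture.Ring2.AbelianAll (ellipticPowerPolarisedAnchorOf weilStructureServedClasses)

/-! ## §0 The new named fact refines the gen-59 fact (hence #22) -/

/-- **The Weil-tensor fact implies the elliptic-power fact** (`andre1996_cmHodgeClasses_ellipticPowerPencils`): instantiate at ANY elliptic curve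
(one exists in the tree — the Weierstrass cubic of `ℤ + iℤ`, `HodgeTheory.exists_abelianVariety_dim_one_cupProduct_ne_zero`) and forget the Weil
structure of the special fibre. [cite: Andre1996Motifs, Lemmes 6.3.2–6.3.3 (pp. 32–33)] -/
theorem andre1996_cmHodgeClasses_ellipticPowerPencils_of_weilTensorPencils (h : andre1996_cmHodgeClasses_weilTensorPencils) :
    andre1996_cmHodgeClasses_ellipticPowerPencils := by
  intro B hB hCM p hp c hc hpp
  obtain ⟨E₀, hE₀, -⟩ := exists_abelianVariety_dim_one_cupProduct_ne_zero
  refine Submodule.span_mono ?_ (h E₀ hE₀ B hB hCM p hp c hc hpp)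
  rintro c' ⟨B', g, w, d, 𝒳, S, f, ⟨hf, s₁, s₀, W, A₁, e₁, g', q, hW, hq, hgw, halg, A₀, e₀, N, ψ₀, hiso, -⟩, rfl⟩
  exact ⟨B', g, w, d, 𝒳, S, f, ⟨hf, s₁, s₀, W, A₁, e₁, g', q, hW, hq, hgw, halg⟩, ⟨s₀, A₀, E₀, N, hE₀, hiso, ⟨e₀⟩⟩, rfl⟩

/-- … hence the road's binder #22 (`andre1996_cmHodgeClasses_algebraicallyAnchoredPencils`). [cite: Andre1996Motifs, Lemmes 6.3.2–6.3.3 (pp. 32–33)] -/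
theorem andre1996_cmHodgeClasses_algebraicallyAnchoredPencils_of_weilTensorPencils (h : andre1996_cmHodgeClasses_weilTensorPencils) :
    andre1996_cmHodgeClasses_algebraicallyAnchoredPencils :=
  andre1996_cmHodgeClasses_algebraicallyAnchoredPencils_of_ellipticPowerPencils
    (andre1996_cmHodgeClasses_ellipticPowerPencils_of_weilTensorPencils h)

variable {𝒪 : ObjClass} {n p : ℕ}
variable {𝒳 S : SchemeOver ℂ} {f : 𝒳 ⟶ S}

/-! ## §1 Compact pencils with a Weil-tensor fibre are served there (anchors: powers of the fixed `E₀`; served: `E`-Weil classes) -/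

/-- **A compact pencil of abelian varieties whose fibre at `s₀` is a Weil-tensor point over `E₀` — `A₀ ≅ 𝒳_{s₀}` isogenous to a power of `E₀`
with an endomorphism `ψ₀` for which `e₀^*(W|_{s₀})` is an `E`-Weil class — is SERVED there** for the anchor data «powers of `E₀`, polarised» / «`(p,p)`
`E`-Weil classes of a CM-field structure»: the relative hyperplane class polarises every fibre and `W|_{s₀}` is of type `(p,p)` and served by
`(A₀, e₀, ψ₀)`. [cite: Andre1996Motifs, proof of Lemme 6.3.3 (p. 33)] [cite: VoisinHodgeI2002, Thm. 7.10 and §7.1.2] -/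
theorem hasServedFibre_compactPencil_of_weilTensorFibre (hf : IsCompactAbelianPencil f n) {E₀ : AbelianVariety ℂ} {s₀ : ComplexPoints S}
    {A₀ : AbelianVariety ℂ} (e₀ : A₀.X ≅ fiberOver f s₀) {N : ℕ} (ψ₀ : A₀ ⟶ A₀) (hiso : A₀.IsIsogenous (E₀.powSucc N))
    (W : complexBetti 𝒳 (2 * p))
    (hW : ∀ s : ComplexPoints S, IsRationalClass (complexBetti.map (fiberι f s) (2 * p) W) ∧
      IsOfHodgeType n (fiberOver f s) (2 * p) p p (complexBetti.map (fiberι f s) (2 * p) W))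
    (hweil : (∃ δ : ℕ, 0 < δ ∧ ψ₀ ≫ ψ₀ = -(δ • 𝟙 A₀) ∧ n = 2 * p ∧
        complexBetti.map e₀.hom (2 * p) (complexBetti.map (fiberι f s₀) (2 * p) W) ∈ weilClassesOf A₀ ψ₀ p δ) ∨
      (∃ (P : Polynomial ℤ) (e' : ℕ),
        P.Monic ∧ P.natDegree = e' ∧ 2 < e' ∧ Irreducible (P.map (Int.castRingHom ℚ)) ∧
          Polynomial.eval₂ (Int.castRingHom (CategoryTheory.End A₀)) (ψ₀ : CategoryTheory.End A₀) P = 0 ∧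
          n = p * e' ∧
          (∀ ρ : ℂ, Polynomial.eval₂ (Int.castRingHom ℂ) ρ P = 0 → starRingEnd ℂ ρ ≠ ρ) ∧
          (∃ Q : Polynomial ℚ, ∀ ρ : ℂ, Polynomial.eval₂ (Int.castRingHom ℂ) ρ P = 0 →
              Polynomial.eval₂ (algebraMap ℚ ℂ) ρ Q = starRingEnd ℂ ρ) ∧
          complexBetti.map e₀.hom (2 * p) (complexBetti.map (fiberι f s₀) (2 * p) W) ∈ weilClassesField A₀ ψ₀ P (2 * p))) :
    HasServedFibre n p (ellipticPowerPolarisedAnchorOf E₀ n) (weilStructureServedClasses n p) f W := by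
  haveI : IsSeparated S.hom :=
    (IsQuasiProjectiveOver.of_isProjectiveOver hf.isSmoothProjective_base.isProjectiveOver).isSeparated
  obtain ⟨Θ, hΘ⟩ := exists_forall_isPolarizationClass_map_fiberι f hf.isSmoothProjectiveFamily
    (IsQuasiProjectiveOver.of_isProjectiveOver hf.isSmoothProjective_total.isProjectiveOver)
  exact ⟨s₀, Θ, fun s ↦ (hΘ s).isRationalClass,
    fun s ↦ isOfHodgeType_of_mem_algebraicClasses_of_isSmoothProjective (hf.isSmoothProjectiveFamily.isSmoothProjective s) 1
      (hΘ s).mem_algebraicClasses,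
    ⟨⟨A₀, N, compactPencil_dim_eq_of_iso hf e₀, hiso, ⟨e₀⟩⟩, hΘ s₀⟩, ⟨(hW s₀).2, A₀, e₀, ψ₀, hweil⟩⟩

/-! ## §2 `HC_CM` from the new fact, the door and carriers for `E`-Weil classes over ONE elliptic curve; `HC_AV` with `HC_CM` idle -/

/-- **`HC_CM` FROM CARRIERS FOR WEIL CLASSES AT TENSOR POINTS OVER ONE ELLIPTIC CURVE**: the Weil-tensor fact ∧ the door for `𝒪` ∧ an elliptic curve
`E₀` with «for all `d`, `p`, `2 ≤ p ≤ d − 2`: on every `X ≅` an abelian `d`-fold isogenous to a power of `E₀`, for every polarisation class `θ` and every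
rational `(p,p)` class `w` that is an `E`-Weil class of a CM-field structure on `X`, an `𝒪`-datum with `κ_p = a·w + c_p·θᵖ`, `a ≠ 0`, sides on the
`θ`-ray» ⟹ `CMHodgeHypothesisAt B` for every `B`. Codimension `≤ 1`: Lefschetz; `p ≥ 2`: each generator `g^*(w)` is algebraic — the pencil is served
at its Weil-tensor fibre (§1), the door and the carriers make `W` algebraic on every fibre of the compact pencil, `e₁`, `g'`, `q ≠ 0`, `g` bring it
to `B`. [cite: Andre1996Motifs, §6.3 b), c), Lemme 6.3.3 and proof (pp. 32–33)] [cite: Milne1999, §7 p. 72] [cite: Bloch1972Semiregularity, Remark (7.5)]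
[cite: BuchweitzFlenner2003, §5 Thm. 5.1] -/
theorem cmHodgeHypothesisAt_of_weilTensorPencils_of_door_of_anchoredCarrierAt (h₂₂ : andre1996_cmHodgeClasses_weilTensorPencils)
    (hT : LocalVariationalHodgeFor 𝒪) {E₀ : AbelianVariety ℂ} (hE₀ : E₀.dim = 1)
    (hcar : ∀ d p : ℕ, 2 ≤ p → p + 2 ≤ d → AnchoredCarrierAt 𝒪 d p (ellipticPowerPolarisedAnchorOf E₀ d) (weilStructureServedClasses d p))
    (B : AbelianVariety ℂ) : CMHodgeHypothesisAt B := by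
  intro hB hCM
  refine (hodgeConjectureFor_iff_of_isSmoothProjective nonempty_hodgeModel_holds hB).2 ?_
  intro p c hc hpp
  by_cases hp : p ≤ 1
  · exact (mem_algebraicClasses_and_divisorClassesSpan_of_offMidRange hB (Or.inl hp) c hc hpp).1
  refine (Submodule.span_le.mpr ?_) (h₂₂ E₀ hE₀ B hB hCM p (by omega) c hc hpp)
  rintro _ ⟨B', g, w, d, 𝒳, S, f, ⟨hf, s₁, s₀, W, A₁, e₁, g', q, hW, hq, hgw, -, A₀, e₀, N, ψ₀, hiso, hweil⟩, rfl⟩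
  -- `W` is algebraic on the fibre `𝒳_{s₁}`: off the mid-range of `d` by Lefschetz, in it by the door and the Weil-tensor carriers
  have h₁ : complexBetti.map (fiberι f s₁) (2 * p) W ∈ algebraicClasses (fiberOver f s₁) p := by
    by_cases hoff : p ≤ 1 ∨ d ≤ p + 1
    · exact (mem_algebraicClasses_and_divisorClassesSpan_of_offMidRange (hf.isSmoothProjectiveFamily.isSmoothProjective s₁) hoff _
        (hW s₁).1 (hW s₁).2).1
    · exact mem_algebraicClasses_compactPencil_of_anchoredCarrierAt_of_hasServedFibre hT (hcar d p (by omega) (by omega)) hf W hW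
        (hasServedFibre_compactPencil_of_weilTensorFibre hf e₀ ψ₀ hiso W hW hweil) s₁
  -- across `e₁`, back along `g'`, divide by `q`, then back along `g`
  have h₂ : complexBetti.map e₁.hom (2 * p) (complexBetti.map (fiberι f s₁) (2 * p) W) ∈ algebraicClasses A₁.X p :=
    (mem_algebraicClasses_map_iff_of_iso e₁).2 h₁
  have h₃ : (q : ℂ) • w ∈ algebraicClasses B'.X p := by
    rw [← hgw]
    exact map_mem_algebraicClasses_of_abelianVariety AbelianVariety.isSmoothProjective_holds A₁ g'.hom.hom.hom h₂
  have h₄ : w ∈ algebraicClasses B'.X p := (Submodule.smul_mem_iff _ (Rat.cast_ne_zero.2 hq)).1 h₃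
  exact map_mem_algebraicClasses_of_abelianVariety hB B' g.hom.hom.hom h₄

/-- **`HC_AV` WITH `HC_CM` IDLE, from carriers for algebraic classes at CM anchors and for `E`-WEIL classes at tensor points over ONE elliptic curve**:
Lemme 6.3.1 ∧ the Weil-tensor fact ∧ the door for `𝒪` ∧ CM-algebraic carriers (`2 ≤ p`, `2p + 4 ≤ n`) ∧ an elliptic curve `E₀` with Weil-tensor carriers
(`2 ≤ p ≤ d − 2`) ⟹ `∀ A, HodgeConjectureFor A.dim A.X`. [cite: Andre1996Motifs, §6.3 Lemmes 6.3.1–6.3.3 (pp. 31–33)] [cite: Bloch1972Semiregularity, Remark (7.5)]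
[cite: BuchweitzFlenner2003, §5 Thm. 5.1] -/
theorem forall_hodgeConjectureFor_of_andre1996_of_weilTensorPencils_of_door_of_carriers (h₂₁ : andre1996_cmAnchoredPencil)
    (h₂₂ : andre1996_cmHodgeClasses_weilTensorPencils) (hT : LocalVariationalHodgeFor 𝒪)
    (hcm : ∀ n p : ℕ, 2 ≤ p → 2 * p + 4 ≤ n → AnchoredCarrierAt 𝒪 n p
      (fun X θ ↦ (∃ A₀ : AbelianVariety ℂ, A₀.dim = n ∧ IsOfCMType A₀ ∧ Nonempty (A₀.X ≅ X)) ∧ IsPolarizationClass n X θ)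
      (fun X _ ↦ (algebraicClasses X p : Set (complexBetti X (2 * p)))))
    {E₀ : AbelianVariety ℂ} (hE₀ : E₀.dim = 1)
    (hell : ∀ d p : ℕ, 2 ≤ p → p + 2 ≤ d → AnchoredCarrierAt 𝒪 d p (ellipticPowerPolarisedAnchorOf E₀ d) (weilStructureServedClasses d p)) :
    ∀ A : AbelianVariety ℂ, HodgeConjectureFor A.dim A.X :=
  forall_hodgeConjectureFor_of_cmAnchoredPencil_of_cmHodge_of_cmAlgebraicCarrierAt h₂₁ hT
    (cmHodgeHypothesisAt_of_weilTensorPencils_of_door_of_anchoredCarrierAt h₂₂ hT hE₀ hell) hcm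

/-- **Twisted-door form of the `HC_CM` row, per `C`** (route binder `TwistedPerfectDoorVHC C AdmTw` by name, any admissibility notion).
[cite: Andre1996Motifs, Lemme 6.3.3 and proof (p. 33)] [cite: Pridham2024Semiregularity, Cor. 2.25 and Rem. 2.26–2.27] [cite: BuchweitzFlenner2003, §5 Thm. 5.1] -/
theorem cmHodgeHypothesisAt_of_weilTensorPencils_of_twistedPerfectDoorVHC_of_anchoredCarrierAt {C : ChernCharacterBetti}
    {Adm : PerfectAdmissibility} (h₂₂ : andre1996_cmHodgeClasses_weilTensorPencils) (hT : TwistedPerfectDoorVHC C Adm) {E₀ : AbelianVariety ℂ}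
    (hE₀ : E₀.dim = 1)
    (hcar : ∀ d p : ℕ, 2 ≤ p → p + 2 ≤ d → AnchoredCarrierAt (twistedReflexiveClass C Adm) d p (ellipticPowerPolarisedAnchorOf E₀ d) (weilStructureServedClasses d p))
    (B : AbelianVariety ℂ) : CMHodgeHypothesisAt B :=
  cmHodgeHypothesisAt_of_weilTensorPencils_of_door_of_anchoredCarrierAt h₂₂ ((twistedPerfectDoorVHC_iff_localVariationalHodgeFor C Adm).1 hT) hE₀
    hcar B

/-! ## §3 The Weil-tensor carrier statement follows from PART AB's elliptic-power-algebraic one, for every `E₀` -/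

/-- **Carriers for ALGEBRAIC classes at elliptic-power anchors ⟹ carriers for `E`-WEIL classes at tensor points over `E₀`** (every `E₀` of
dimension `1`, every `(n, p)`): the new anchors are elliptic-power anchors, and a served class that is RATIONAL (as `AnchoredCarrierAt` asks) and of
type `(p,p)` on an abelian variety isogenous to a power of an elliptic curve is ALGEBRAIC (Tate–Murasaki; `mem_algebraicClasses_of_ellipticPowerAnchor`).
So PART AB's `B_min` SHRINKS to the Weil spaces. [cite: vanGeemen1994HodgeAV, Lemma 3.7 and Thm. 4.3] [cite: Bloch1972Semiregularity, Remark (7.5)] -/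
theorem weilTensorCarrierAt_of_ellipticPowerAlgebraicCarrierAt {E₀ : AbelianVariety ℂ} (hE₀ : E₀.dim = 1)
    (h : AnchoredCarrierAt 𝒪 n p
      (fun X θ ↦ (∃ (A₀ E₀' : AbelianVariety ℂ) (N : ℕ), A₀.dim = n ∧ E₀'.dim = 1 ∧ A₀.IsIsogenous (E₀'.powSucc N) ∧
        Nonempty (A₀.X ≅ X)) ∧ IsPolarizationClass n X θ)
      (fun X _ ↦ (algebraicClasses X p : Set (complexBetti X (2 * p))))) :
    AnchoredCarrierAt 𝒪 n p (ellipticPowerPolarisedAnchorOf E₀ n) (weilStructureServedClasses n p) := by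
  intro X θ hXθ w hw hwQ
  obtain ⟨⟨A₀, N, hd, hiso, ⟨e₀⟩⟩, hθ⟩ := hXθ
  exact h X θ ⟨⟨A₀, E₀, N, hd, hE₀, hiso, ⟨e₀⟩⟩, hθ⟩ w (mem_algebraicClasses_of_ellipticPowerAnchor hd hE₀ hiso e₀ hwQ hw.1) hwQ

end Summit.HodgeConjecture.HodgeConjecture.Ring2.SemiregularRepresentatives

end
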